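import Summits.BirchSwinnertonDyer.BirchSwinnertonDyer.Theorems.ResidualThetaTransportAtTwoResidualThetaMainConjectureAtTwoAnalyticLayerLawAtTwo
import HarnessLib

/-!
# Crux `ResidualThetaMainConjectureAtTwo` (stmt-BirchSwinnertonDyer-20787), line `birth` — by-product:
# READING `λ(L⁻)` OFF THE MAZUR–TATE LAYERS at `p = 2`: `λ_n(θ_n(f)) = (2ⁿ − 1)/3 + λ(L⁻)` (even `n ≫ 0`)

Cell `bsd-wall`, seat `bsd-wall-rtt-p2` (LEAD PROVER, line mode). THEOREMS ONLY (no `def`, no named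
fact, no `sorry`). The undepleted (`S₀ = ∅`) special case of stub R2, stated for ANY weight-2 cusp form
`f` on `Γ₀(N)` admitting a Pollack pair `(L⁺, L⁻)` at `2` (`IsPollackPair f 2 L⁺ L⁻`: Pollack 2003
Prop. 6.18 congruences): for all large even `n`, Pollack–Weston's layer `λ`-invariant of the Mazur–Tate
element `θ_n(f)` read in `ℚ̄₂[X]` is `(2ⁿ − 1)/3 + lam L⁻` — Kurihara's `q_n + λ` law at `p = 2`
(`q_n = deg ω_n^- = (2ⁿ − 1)/3` for even `n`). This is the kernel form of the reading used by the
cell's layer tables (KIT-RESULT-TP2-CM-ANCHORS-v1: `λ(θ_n) = λ♭ + (2ⁿ − 1)/3` on 33 classes): a certified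
`λ_n(θ_n)` at one large even layer determines `lam L⁻`. No curve, no main conjecture, no BSD claim.

References: R. Pollack, Duke Math. J. 118 (2003) Prop. 6.18 [Pollack2003]; M. Kurihara, Invent. Math.
149 (2002) [Kurihara2002]; R. Pollack, T. Weston, Duke Math. J. 156 (2011) §3.1, §4 [PollackWeston2011MT].
-/

set_option linter.dupNamespace false
set_option autoImplicit false

noncomputable section

open scoped Classical

open Polynomial Literature.NumberTheory.EllipticCurves Literature.NumberTheory.IwasawaTheory
  Summit.BirchSwinnertonDyer.Rank1Residual.X1.MuLambda Summit.BirchSwinnertonDyer.Rank1Residual.Supersingular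

namespace Summit.BirchSwinnertonDyer.BirchSwinnertonDyer.Theorems.ResidualThetaLayer

open scoped MatrixGroups ModularForm in
/-- **`λ_n(θ_n(f)) = (2ⁿ − 1)/3 + λ(L⁻)` for all large even `n`** (layer `λ` of Pollack–Weston §3.1 of
`θ_n(f) ∈ ℚ[X] ⊂ ℚ̄₂[X]`), for any weight-2 cusp form `f` on `Γ₀(N)` with a Pollack pair `(L⁺, L⁻)` at `2`.
Threshold: `n ≥ 2·lam L⁻ + 2`. [cite: Pollack2003, Prop. 6.18] [cite: PollackWeston2011MT, §3.1 and §4] -/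
theorem layerLambda_mazurTateElement_two_of_isPollackPair {N : ℕ} (f : CuspForm (CongruenceSubgroup.Gamma0 N) 2)
    {Lplus Lminus : IwasawaAlgebra 2} (hPP : IsPollackPair f 2 Lplus Lminus) {n : ℕ}
    (hn : 2 * lam Lminus + 2 ≤ n) (heven : Even n) :
    layerLambda ((mazurTateElement f 2 n).map (algebraMap ℚ (PadicAlgCl 2))) = (2 ^ n - 1) / 3 + lam Lminus := by
  set φ : ℤ_[2] →+* PadicAlgCl 2 := (algebraMap ℚ_[2] (PadicAlgCl 2)).comp (algebraMap ℤ_[2] ℚ_[2])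
    with hφdef
  have hφ : ∀ x, ‖φ x‖ = ‖x‖ := norm_algebraMap_padicInt_padicAlgCl
  have hLm : Lminus ≠ 0 := hPP.2.1
  obtain ⟨j, hj⟩ := heven
  have hj2 : (n + 1) / 2 = j := by omega
  set d : ℕ := (2 ^ n - 1) / 3 with hd
  have hω : ((-1) ^ (n / 2 + 1) * cyclotomicOmegaMinus 2 n).map (Int.castRingHom (ZMod 2)) =
      C ((-1 : ZMod 2) ^ (n / 2 + 1)) * X ^ d := by
    rw [Polynomial.map_mul, Polynomial.map_pow, Polynomial.map_neg, Polynomial.map_one,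
      map_cyclotomicOmegaMinus_zmod, hj2, sum_two_pow_layer, show 2 * j = n by omega, ← hd, map_pow, map_neg,
      C_1]
  have hu : ((-1 : ZMod 2) ^ (n / 2 + 1)) ≠ 0 := pow_ne_zero _ (neg_ne_zero.mpr one_ne_zero)
  have hθcoeff : ∀ i, 2 ^ n ≤ i → (mazurTateElement f 2 n).coeff i = 0 := fun i hi ↦
    coeff_eq_zero_of_natDegree_lt (lt_of_lt_of_le (natDegree_mazurTateElement_lt f 2 n) hi)
  have hd' : d + lam Lminus < 2 ^ n := layer_room hn
  obtain ⟨P, μ, hθP, hordP⟩ := exists_integralModel_of_isCongrModOmega (hPP.2.2.2 n ⟨j, hj⟩) hLm hθcoeff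
    hω hu hd'
  have hφrat : (algebraMap ℚ_[2] (PadicAlgCl 2)).comp (algebraMap ℚ ℚ_[2]) = algebraMap ℚ (PadicAlgCl 2) :=
    RingHom.ext_rat _ _
  have hθmap : (mazurTateElement f 2 n).map (algebraMap ℚ (PadicAlgCl 2)) =
      C ((2 : PadicAlgCl 2) ^ μ) * P.map φ := by
    rw [← hφrat, ← Polynomial.map_map, hθP, Polynomial.map_mul, Polynomial.map_C, map_pow, map_natCast,
      Nat.cast_ofNat, Polynomial.map_map]
  rw [hθmap, layerLambda_C_mul (pow_ne_zero _ two_ne_zero), (layerLambda_map_eq_of_order φ hφ hordP).1]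

end Summit.BirchSwinnertonDyer.BirchSwinnertonDyer.Theorems.ResidualThetaLayer

end
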